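import Literature.NumberTheory.Automorphic.Liu2021.AppendixC.HeckeImageRosatiStable
import Literature.LinearAlgebra.InverseBilinearFormTransport
import HarnessLib

/-!
# [Liu 2021, App. D p. 133 / §4.2] V-side Rosati adjointness ⇒ adjointness for the tower form on `H¹_ét(A_∞)` — the (T3c) `hadj` junction
# of the road (P) toward the S2′ socket `SocketRos`

Topic `NumberTheory/Automorphic/Liu2021/AppendixC`; namespaces `Literature.LinearAlgebra` (§1, generic) and
`Literature.NumberTheory.Automorphic.Liu2021.AppendixC.Sec42Data[.HeckeTranslates]` (§2–§3).  THEOREMS ONLY (no definition, no named fact, no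
instance, no `sorry`).  Cell `hodgecm-mathlib` (D-0151), fan A, count-neutral capital (`--supports stmt-HodgeConjecture-24832`): A-plan2 (g12)
word 2026-08-30T03:29:55Z.  HC_CM is proved only modulo the 7 printed citations until rung 0 closes; nothing of [Liu2021] is asserted here.

THE JUNCTION.  ★ (T3b) `HeckeImageRosatiStable.forall_exists_isPositiveAntiInvolution_heckeImage_stable` delivers the socket `SocketRos`
(«a positive anti-involution of `End⁰(A_K)` stabilising the Hecke image», every level `K`) from an `etHeckeRep`-invariant tower form `B`,
its level-wise right separation `hsep`, and the adjointness `hadj : B [ᵗV_ℓ(x) φ]_K [ψ]_K = B [φ]_K [ᵗV_ℓ(ι_K x) ψ]_K` on the DUAL side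
`H¹_ét(A_K) = (V_ℓ A_K)^∨`.  The producers of the road (P) speak on `V_ℓ A_K`: the `ℓ`-adic Weil pairing `eV K` of the level polarisation
(a perfect pairing), the Rosati involution `ι_K`, and «Rosati is the `ē`-adjoint», `eV K (V_ℓ(ι_K x) a) b = eV K a (V_ℓ(x) b)` ([MumfordAV1970]
§20 p. 189 `E^L(φx, y) = E^L(x, φ′y)`; the tree's ★ `weilPairingLevel_map_rosatiDual` on torsion points).  The tower form of ★ (T2d)
`EtaleH1TowerWeilPairing.exists_bilinForm_etaleH1Tower_of_adjoint` has the level formula `B [φ]_K [ψ]_K = w K • (eV K)^ (φ, ψ)` with Bourbaki's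
inverse form `(eV K)^ = inverseForm (eV K)` (★ `Literature.LinearAlgebra.inverseForm`).  This file closes the gap:

* §1 (generic, Bourbaki IX §1 no. 8) **`inverseForm_isAdjointPair_dualMap`** — for a perfect pairing `Φ` on `M` and an adjoint pair
  `Φ x (u z) = Φ (u′ x) z`, the transposes are an adjoint pair for the inverse form: `Φ̂ (ᵗu φ) ψ = Φ̂ φ (ᵗu′ ψ)` (★ (T2c)
  `dualMap_eq_toPerfPair_symm` + ★ `inverseForm_apply`).
* §2 **`bilinForm_toTower_dualMap_rationalTateAction_of_adjoint`** — for ANY `B` with the level formula `B [φ]_K [ψ]_K = w K • (eV K)^ (φ, ψ)`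
  and ANY self-map `ι_K` of `End⁰(A_K)` with the V-side adjointness, the `H¹`-side adjointness `hadj` of ★ (T3b); `…_separatingRight_level` —
  `hsep` of ★ (T3b) from `w K ≠ 0` (★ (T2c) `nondegenerate_inverseForm`).
* §3 **`forall_exists_isPositiveAntiInvolution_heckeImage_stable_of_adjointV`** — the socket `SocketRos T hD` VERBATIM from V-SIDE data:
  `(eV, w, hw)`, a tower form `B` with the level formula and `etHeckeRep`-invariance (the two conjuncts of ★ (T2d)'s `∃ B`), and per level a
  positive anti-involution `ι K` which is the `eV K`-adjoint.  Residue of `SocketRos` after this file = exactly the producers' V-side outputs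
  {`eV` + `hV` (Weil pairings of the level polarisations and their translate law), `ι` + positivity + `eV`-adjointness (Rosati)}.

## References
* [Liu2021] Y. Liu, *Fourier–Jacobi cycles and arithmetic relative trace formula*, Camb. J. Math. 9 (2021): App. D p. 133 (before (D.3)) and §4.2
  (FJcycle.tex l. 2074, 2158–2160; print pp. 49–50).
* [BourbakiAlgebreIX2007] N. Bourbaki, *Algèbre, Chapitre 9*: §1 no. 7 formula (27), no. 8 Prop. 7, Remarque (34).
* [MumfordAV1970] D. Mumford, *Abelian Varieties* (1970), §20 (the Rosati involution as the `E^L`-adjoint), §21 Thm. 1 (positivity).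
* Tree: ★ (T3b) `AppendixC.HeckeImageRosatiStable`, ★ (T2c) `LinearAlgebra.InverseBilinearFormTransport` (`dualMap_eq_toPerfPair_symm`,
  `nondegenerate_inverseForm`), ★ `LinearAlgebra.InverseBilinearForm` (`inverseForm`, `inverseForm_apply`), ★ (T2b) `AppendixC.EtaleH1TowerPairing`,
  (T2d) `AppendixC.EtaleH1TowerWeilPairing` (the `∃ B` with this level formula).
-/

set_option autoImplicit false

/-! ## §1 Generic: transposes of an adjoint pair are an adjoint pair for the inverse form -/

namespace Literature.LinearAlgebra

open Function Module

universe u v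

variable {R : Type u} [CommRing R] {M : Type v} [AddCommGroup M] [Module R M]

/-- **Transposes of an adjoint pair are adjoint for the inverse form.**  For a perfect pairing `Φ` on `M` and linear `u, u′ : M → M` with
`Φ x (u z) = Φ (u′ x) z` (Bourbaki's (31): `u′` is the adjoint of `u`), the transposes satisfy `Φ̂ (ᵗu φ) ψ = Φ̂ φ (ᵗu′ ψ)` for the inverse form
`Φ̂ = inverseForm Φ` on `M*` — both sides equal `ψ (u′ (s_Φ⁻¹ φ))` by (34) `ᵗu = s_Φ ∘ u′ ∘ s_Φ⁻¹` (★ `dualMap_eq_toPerfPair_symm`) and (27)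
`Φ̂ (y′, x′) = ⟨s_Φ⁻¹ y′, x′⟩`. [cite: BourbakiAlgebreIX2007, §1 no. 8 Prop. 7, Remarque (34)] [cite: BourbakiAlgebreIX2007, §1 no. 7 formula (27)] -/
theorem inverseForm_isAdjointPair_dualMap (Φ : LinearMap.BilinForm R M) [Φ.IsPerfPair] (u u' : M →ₗ[R] M)
    (hadj : ∀ x z : M, Φ x (u z) = Φ (u' x) z) :
    LinearMap.IsAdjointPair (inverseForm Φ) (inverseForm Φ) u.dualMap u'.dualMap := by
  intro φ ψ
  rw [inverseForm_apply, inverseForm_apply, dualMap_eq_toPerfPair_symm Φ Φ u u' hadj φ, LinearEquiv.symm_apply_apply,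
    LinearMap.dualMap_apply]

/-- The same with the adjoint pair written the other way round (`Φ (u′ x) z = Φ x (u z)`, the «Rosati is the adjoint» orientation
`E(φ′x, y) = E(x, φy)`). [cite: BourbakiAlgebreIX2007, §1 no. 8 Prop. 7, Remarque (34)] -/
theorem inverseForm_isAdjointPair_dualMap' (Φ : LinearMap.BilinForm R M) [Φ.IsPerfPair] (u u' : M →ₗ[R] M)
    (hadj : ∀ x z : M, Φ (u' x) z = Φ x (u z)) :
    LinearMap.IsAdjointPair (inverseForm Φ) (inverseForm Φ) u.dualMap u'.dualMap :=
  inverseForm_isAdjointPair_dualMap Φ u u' fun x z => (hadj x z).symm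

end Literature.LinearAlgebra

/-! ## §2 The tower: `H¹`-side adjointness and level-wise separation from V-side data -/

noncomputable section

open CategoryTheory NumberField MulAction Function
open Literature.AlgebraicGeometry.Motives.AbelianVariety (rationalTateAction)
open Literature.RingTheory.CentralSimple
open Literature.LinearAlgebra

namespace Literature.NumberTheory.Automorphic.Liu2021.AppendixC

variable {F E : Type} [Field F] [NumberField F] [IsTotallyReal F] [Field E] [NumberField E] [Algebra F E]
  [IsTotallyComplex E] [Algebra.IsQuadraticExtension F E]
variable {P5 : PropC5Data F E} {isotropicAt : ℕ → Prop}

namespace Sec42Data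

variable (C : Sec42Data P5 isotropicAt) (ℓ : ℕ) [Fact ℓ.Prime]

/-- **`hadj` on `H¹` from Rosati adjointness on `V_ℓ`, one level.**  For a perfect pairing `eV` on `V_ℓ A_K`, ANY bilinear form `B` on the tower
with the level formula `B [φ]_K [ψ]_K = w • eV^ (φ, ψ)`, and ANY self-map `ι` of `End⁰(A_K)` with `eV (V_ℓ(ι x) a) b = eV a (V_ℓ(x) b)`:
`B [ᵗV_ℓ(x) φ]_K [ψ]_K = B [φ]_K [ᵗV_ℓ(ι x) ψ]_K` — the `hadj` input of ★ (T3b) `HeckeImageRosatiStable` at level `K`.  Ours.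
[cite: Liu2021, p. 133 (before (D.3)) and §4.2 (FJcycle.tex l. 2074)] [cite: BourbakiAlgebreIX2007, §1 no. 8 Prop. 7, Remarque (34)] -/
theorem bilinForm_toTower_dualMap_rationalTateAction_of_adjoint (K : C5.SmallLevel C.S.K₀)
    (eV : LinearMap.BilinForm ℚ_[ℓ] ((C.A K).rationalTateModule ℓ)) [eV.IsPerfPair] (w : ℚ_[ℓ])
    {B : LinearMap.BilinForm ℚ_[ℓ] (C.etaleH1Tower ℓ)}
    (hB : ∀ φ ψ : C.etaleH1 ℓ K, B (C.toTower ℓ K φ) (C.toTower ℓ K ψ) = w • inverseForm eV φ ψ)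
    (ι : (C.A K).endAlgebra → (C.A K).endAlgebra)
    (hadjV : ∀ (x : (C.A K).endAlgebra) (a b : (C.A K).rationalTateModule ℓ),
      eV (rationalTateAction (C.A K) ℓ (ι x) a) b = eV a (rationalTateAction (C.A K) ℓ x b))
    (x : (C.A K).endAlgebra) (φ ψ : C.etaleH1 ℓ K) :
    B (C.toTower ℓ K ((rationalTateAction (C.A K) ℓ x).dualMap φ)) (C.toTower ℓ K ψ) =
      B (C.toTower ℓ K φ) (C.toTower ℓ K ((rationalTateAction (C.A K) ℓ (ι x)).dualMap ψ)) := by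
  rw [hB, hB, inverseForm_isAdjointPair_dualMap' eV (rationalTateAction (C.A K) ℓ x) (rationalTateAction (C.A K) ℓ (ι x)) (hadjV x) φ ψ]

/-- **All levels at once**, in the binder shape of ★ (T3b) `forall_exists_isPositiveAntiInvolution_heckeImage_stable`: from a family of perfect
pairings `eV K` on the `V_ℓ A_K`, weights `w`, a tower form with the level formula, and self-maps `ι K` which are the `eV K`-adjoints, the
family `hadj`.  Ours. [cite: Liu2021, p. 133 (before (D.3)) and §4.2 (FJcycle.tex l. 2074)] [cite: BourbakiAlgebreIX2007, §1 no. 8 Prop. 7, Remarque (34)] -/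
theorem bilinForm_toTower_dualMap_rationalTateAction_of_forall_adjoint
    (eV : ∀ K : C5.SmallLevel C.S.K₀, LinearMap.BilinForm ℚ_[ℓ] ((C.A K).rationalTateModule ℓ))
    [∀ K : C5.SmallLevel C.S.K₀, (eV K).IsPerfPair] (w : C5.SmallLevel C.S.K₀ → ℚ_[ℓ])
    {B : LinearMap.BilinForm ℚ_[ℓ] (C.etaleH1Tower ℓ)}
    (hB : ∀ (K : C5.SmallLevel C.S.K₀) (φ ψ : C.etaleH1 ℓ K), B (C.toTower ℓ K φ) (C.toTower ℓ K ψ) = w K • inverseForm (eV K) φ ψ)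
    (ι : ∀ K : C5.SmallLevel C.S.K₀, (C.A K).endAlgebra →ₗ[ℚ] (C.A K).endAlgebra)
    (hadjV : ∀ (K : C5.SmallLevel C.S.K₀) (x : (C.A K).endAlgebra) (a b : (C.A K).rationalTateModule ℓ),
      eV K (rationalTateAction (C.A K) ℓ (ι K x) a) b = eV K a (rationalTateAction (C.A K) ℓ x b))
    (K : C5.SmallLevel C.S.K₀) (x : (C.A K).endAlgebra) (φ ψ : C.etaleH1 ℓ K) :
    B (C.toTower ℓ K ((rationalTateAction (C.A K) ℓ x).dualMap φ)) (C.toTower ℓ K ψ) =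
      B (C.toTower ℓ K φ) (C.toTower ℓ K ((rationalTateAction (C.A K) ℓ (ι K x)).dualMap ψ)) :=
  C.bilinForm_toTower_dualMap_rationalTateAction_of_adjoint ℓ K (eV K) (w K) (hB K) (ι K) (hadjV K) x φ ψ

/-- **`hsep` at one level from a non-zero weight**: with the level formula `B [φ]_K [ψ]_K = w • eV^ (φ, ψ)` and `w ≠ 0`, the level-`K`
restriction of `B` is right-separating — the inverse form of a perfect pairing is non-degenerate (★ (T2c) `nondegenerate_inverseForm`).  Ours.
[cite: Liu2021, §4.2 (FJcycle.tex l. 2158; print pp. 49–50)] [cite: BourbakiAlgebreIX2007, §1 no. 7 formula (27)] -/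
theorem toTower_separatingRight_of_inverseForm (K : C5.SmallLevel C.S.K₀)
    (eV : LinearMap.BilinForm ℚ_[ℓ] ((C.A K).rationalTateModule ℓ)) [eV.IsPerfPair] {w : ℚ_[ℓ]} (hw : w ≠ 0)
    {B : LinearMap.BilinForm ℚ_[ℓ] (C.etaleH1Tower ℓ)}
    (hB : ∀ φ ψ : C.etaleH1 ℓ K, B (C.toTower ℓ K φ) (C.toTower ℓ K ψ) = w • inverseForm eV φ ψ)
    (ψ : C.etaleH1 ℓ K) (hψ : ∀ φ : C.etaleH1 ℓ K, B (C.toTower ℓ K φ) (C.toTower ℓ K ψ) = 0) : ψ = 0 :=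
  (nondegenerate_inverseForm eV).2 ψ fun φ => by
    have h := hψ φ
    rw [hB] at h
    exact (smul_eq_zero.1 h).resolve_left hw

end Sec42Data

/-! ## §3 The socket `SocketRos` from V-side data -/

namespace Sec42Data.HeckeTranslates

variable {C : Sec42Data P5 isotropicAt} (T : C.HeckeTranslates) (ℓ : ℕ) [Fact ℓ.Prime]

/-- **`SocketRos` from V-SIDE data.**  Given, at every small level `K`: a perfect pairing `eV K` on `V_ℓ A_K` (the `ℓ`-adic Weil pairing of the
level polarisation) and a non-zero weight `w K`; a bilinear form `B` on `H¹_ét(A_∞)` with the level formula `B [φ]_K [ψ]_K = w K • (eV K)^ (φ, ψ)`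
which is `etHeckeRep`-invariant (the two conjuncts delivered by ★ (T2d) `exists_bilinForm_etaleH1Tower_of_adjoint`); and a POSITIVE
anti-involution `ι K` of `End⁰(A_K)` which is the `eV K`-adjoint, `eV K (V_ℓ(ι_K x) a) b = eV K a (V_ℓ(x) b)` (Rosati, [MumfordAV1970] §20–§21):
for every `K`, `∃ τ, IsPositiveAntiInvolution (End⁰ A_K) τ ∧ ∀ x ∈ heckeImage K, τ x ∈ heckeImage K` — the cell's socket `SocketRos T hD`
VERBATIM (★ (T3b) with `hadj`, `hsep` supplied by §2).  Ours. [cite: Liu2021, p. 133 (before (D.3)) and §4.2 (FJcycle.tex l. 2074)]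
[cite: MumfordAV1970, §21 Thm. 1] -/
theorem forall_exists_isPositiveAntiInvolution_heckeImage_stable_of_adjointV (hD : T.IsogenyDescent)
    (eV : ∀ K : C5.SmallLevel C.S.K₀, LinearMap.BilinForm ℚ_[ℓ] ((C.A K).rationalTateModule ℓ))
    [∀ K : C5.SmallLevel C.S.K₀, (eV K).IsPerfPair] (w : C5.SmallLevel C.S.K₀ → ℚ_[ℓ]) (hw : ∀ K : C5.SmallLevel C.S.K₀, w K ≠ 0)
    (B : LinearMap.BilinForm ℚ_[ℓ] (C.etaleH1Tower ℓ))
    (hB : ∀ (K : C5.SmallLevel C.S.K₀) (φ ψ : C.etaleH1 ℓ K), B (C.toTower ℓ K φ) (C.toTower ℓ K ψ) = w K • inverseForm (eV K) φ ψ)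
    (hBinv : ∀ (g : C.G) (x y : C.etaleH1Tower ℓ), B (T.etHeckeRep ℓ g x) (T.etHeckeRep ℓ g y) = B x y)
    (ι : ∀ K : C5.SmallLevel C.S.K₀, (C.A K).endAlgebra →ₗ[ℚ] (C.A K).endAlgebra)
    (hι : ∀ K : C5.SmallLevel C.S.K₀, IsPositiveAntiInvolution (C.A K).endAlgebra (ι K))
    (hadjV : ∀ (K : C5.SmallLevel C.S.K₀) (x : (C.A K).endAlgebra) (a b : (C.A K).rationalTateModule ℓ),
      eV K (rationalTateAction (C.A K) ℓ (ι K x) a) b = eV K a (rationalTateAction (C.A K) ℓ x b))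
    (K : C5.SmallLevel C.S.K₀) :
    ∃ τ : (C.A K).endAlgebra →ₗ[ℚ] (C.A K).endAlgebra,
      IsPositiveAntiInvolution (C.A K).endAlgebra τ ∧ ∀ x ∈ T.heckeImage hD K, τ x ∈ T.heckeImage hD K :=
  T.forall_exists_isPositiveAntiInvolution_heckeImage_stable ℓ hD B hBinv
    (fun K' => C.toTower_separatingRight_of_inverseForm ℓ K' (eV K') (hw K') (hB K'))
    ι hι (C.bilinForm_toTower_dualMap_rationalTateAction_of_forall_adjoint ℓ eV w hB ι hadjV) K

end Sec42Data.HeckeTranslates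

end Literature.NumberTheory.Automorphic.Liu2021.AppendixC

end
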